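import Summits.CriticalPhenomena.PercolationContinuityZ3.Theorems.PercNearOneGluingNoHeavyLowerTailSahiTangentVertexContraction
import Literature.Combinatorics.Sahi2008.UniformSquareAllOrders

/-!
# `NoHeavyLowerTail` (crux stmt-CriticalPhenomena-4575), Sahi programme: **COIN-CYLINDER SLOTS** — the calculus that reduces the all-orders
# contraction inequality for cylinder PAIRS to the vertex theorem (interpolation in scalar defects; frozen pair families ARE scalar families)

Support file (Sahi cell, seat `prim-sahi-p1`, generation 50; `--supports stmt-CriticalPhenomena-4575`).  Standard axioms, no `sorry`.  ONE definition:
the coin-cylinder slot `cSlot t β κ (ε, ω) = ε ? 1_{t ⊆ ω} : κ·1_{β ⊆ ω}` on the two-layer space `Bool × Set ι` (top cylinder `t`, bottom cylinder `β`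
damped by the scalar `κ`).  A CYLINDER PAIR `t ⊆ b` is `cSlot t b 1`; a PLAIN vertex slot is `cSlot t t 1 = vtxSlot false t`, a TOP-ONLY one is
`cSlot t β 0 = vtxSlot true t` (`…SahiTangentVertexFamilies`).

THE CALCULUS.  Products of coin-cylinder slots are coin-cylinder slots (`cSlot_mul`, `prod_cSlot`: tops and bottoms unite, scalars multiply), and under
the two-layer weight `B_s ⊗ μ`, `μ = bernoulliWeight q`, `E(cSlot T B K) = s·M(T) + (1−s)·K·M(B)` (`ex_cSlot`, `M = cylMass`).  Hence every mixed moment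
of a family of such slots is explicit, and two tools of the tree apply verbatim: `E_n` sees a slot only through its mixed moments
(`sahiE_update_congr_of_moments`) and is linear in each slot (`sahiE_update_lin`).

THE RESULTS.
* `sahiE_coin_scalar_ge` (INTERPOLATION): for scalar families `F_l = cSlot t_l t_l κ_l`, `κ ∈ [0,1]^n`, at EVERY order `n`:
  `s·E_n^{μ}(1_{C(t_l)}) ≤ E_n^{B_s⊗μ}(F)` — each slot is the convex combination `κ_l·(plain) + (1−κ_l)·(top-only)`, so by linearity slot after slot
  the claim reduces to the `2^n` vertex families, where it is Theorem V (`vtxD_nonneg`, gen 49).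
* `sahiE_coin_pairs_eq_scalar_of_frozen` (FROZEN TRANSFER): if the defects `d_l = b_l ∖ t_l` of a pair family are disjoint from the other bottoms
  (`Disjoint (b_l ∖ t_l) (b_j)`, `j ≠ l`), then `E_n^{B_s⊗μ}(cSlot t_l b_l 1) = E_n^{B_s⊗μ}(cSlot t_l t_l M(d_l))`: slot by slot the mixed moments agree,
  because `M(b_l ∪ B) = M(d_l)·M(t_l ∪ B)` for every union `B` of the other slots' cylinders (product measure, `d_l` disjoint from `t_l ∪ B`).
  With the interpolation this proves the contraction inequality for FROZEN pair families at every order; the general pair family is reduced to a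
  frozen one by erasure in `…SahiTangentCylinderPairsAllOrders` (memo FROM-prim-sahi-p1-gen49-PRINCIPAL-BOTTOM-TANGENT §A2/§A6, gen-50 memo).
Nothing conjectural is asserted. [this work]
-/

namespace Summit.CriticalPhenomena.PercolationContinuityZ3.Theorems.SahiTangentCyl

open Finset Function Literature.Combinatorics.Sahi2008
open Literature.Probability.Percolation.DecisionTree (ind ind_of_mem ind_of_not_mem ind_nonneg)
open scoped BigOperators

noncomputable section

variable {ι : Type*} [DecidableEq ι]

/-! ### Coin-cylinder slots -/

/-- **Coin-cylinder slot** on `Bool × Set ι`: the top-layer cylinder indicator `1_{t ⊆ ω}` on `ε = true`, and `κ·1_{β ⊆ ω}` on `ε = false`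
(bottom cylinder `β`, damped by the scalar `κ`).  `cSlot t b 1` is the cylinder PAIR `(t, b)`; `cSlot t t 1` / `cSlot t β 0` are the plain / top-only
vertex slots. [this work] -/
def cSlot (t β : Finset ι) (κ : ℝ) : Bool × Set ι → ℝ :=
  fun z => if z.1 then ind {ω : Set ι | (t : Set ι) ⊆ ω} z.2 else κ * ind {ω : Set ι | (β : Set ι) ⊆ ω} z.2

omit [DecidableEq ι] in
/-- The pair slot written as in the order-3/4 theorems is `cSlot t b 1`. [this work] -/
theorem cSlot_one_eq_pair (t b : Finset ι) :
    (fun z : Bool × Set ι => if z.1 then ind {ω : Set ι | (t : Set ι) ⊆ ω} z.2 else ind {ω : Set ι | (b : Set ι) ⊆ ω} z.2) = cSlot t b 1 := by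
  funext z; rcases z with ⟨e, ω⟩; cases e <;> simp [cSlot]

omit [DecidableEq ι] in
/-- `cSlot t t 1` is the plain vertex slot. [this work] -/
theorem cSlot_self_one (t : Finset ι) : cSlot t t 1 = vtxSlot false t := by
  funext z; rcases z with ⟨e, ω⟩; cases e <;> simp [cSlot, vtxSlot]

omit [DecidableEq ι] in
/-- `cSlot t β 0` is the top-only vertex slot. [this work] -/
theorem cSlot_zero (t β : Finset ι) : cSlot t β 0 = vtxSlot true t := by
  funext z; rcases z with ⟨e, ω⟩; cases e <;> simp [cSlot, vtxSlot]

omit [DecidableEq ι] in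
/-- A coin-cylinder slot is the affine interpolation of its `κ = 1` and `κ = 0` versions. [this work] -/
theorem cSlot_lin (t β : Finset ι) (κ : ℝ) : cSlot t β κ = κ • cSlot t β 1 + (1 - κ) • cSlot t β 0 := by
  funext z; rcases z with ⟨e, ω⟩
  cases e <;> simp only [cSlot, Pi.add_apply, Pi.smul_apply, smul_eq_mul, if_true, Bool.false_eq_true, if_false] <;> ring

/-- Pointwise product of two cylinder indicators. [this work] -/
theorem ind_cyl_mul_apply (σ τ : Finset ι) (ω : Set ι) :
    ind {ω : Set ι | (σ : Set ι) ⊆ ω} ω * ind {ω : Set ι | (τ : Set ι) ⊆ ω} ω = ind {ω : Set ι | ((σ ∪ τ : Finset ι) : Set ι) ⊆ ω} ω := by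
  by_cases hσ : (σ : Set ι) ⊆ ω <;> by_cases hτ : (τ : Set ι) ⊆ ω <;>
    simp [ind_of_mem, ind_of_not_mem, hσ, hτ, coe_union, Set.union_subset_iff]

/-- **Slot calculus**: the product of two coin-cylinder slots is the coin-cylinder slot of the unions, with the product scalar. [this work] -/
theorem cSlot_mul (t₁ β₁ t₂ β₂ : Finset ι) (κ₁ κ₂ : ℝ) :
    cSlot t₁ β₁ κ₁ * cSlot t₂ β₂ κ₂ = cSlot (t₁ ∪ t₂) (β₁ ∪ β₂) (κ₁ * κ₂) := by
  funext z; rcases z with ⟨e, ω⟩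
  cases e
  · simp only [cSlot, Pi.mul_apply, Bool.false_eq_true, if_false]
    rw [← ind_cyl_mul_apply]; ring
  · simp only [cSlot, Pi.mul_apply, if_true]
    exact ind_cyl_mul_apply t₁ t₂ ω

/-- **Products of a family of coin-cylinder slots.** [this work] -/
theorem prod_cSlot {n : ℕ} (t β : Fin n → Finset ι) (κ : Fin n → ℝ) (S : Finset (Fin n)) :
    ∏ l ∈ S, cSlot (t l) (β l) (κ l) = cSlot (S.biUnion t) (S.biUnion β) (∏ l ∈ S, κ l) := by
  induction S using Finset.induction_on with
  | empty =>
    funext z; rcases z with ⟨e, ω⟩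
    cases e <;> simp [cSlot, ind_of_mem (Set.mem_univ ω)]
  | insert a s ha ih =>
    rw [Finset.prod_insert ha, Finset.prod_insert ha, ih, cSlot_mul, Finset.biUnion_insert, Finset.biUnion_insert]

omit [DecidableEq ι] in
/-- Slotwise description of an updated coin-cylinder family (bookkeeping). [this work] -/
theorem update_cSlot_family {n : ℕ} (t β : Fin n → Finset ι) (κ : Fin n → ℝ) (l₀ : Fin n) (β₀ : Finset ι) (κ₀ : ℝ) :
    update (fun l => cSlot (t l) (β l) (κ l)) l₀ (cSlot (t l₀) β₀ κ₀) = fun l => cSlot (t l) (update β l₀ β₀ l) (update κ l₀ κ₀ l) := by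
  funext l
  by_cases h : l = l₀
  · subst h; simp
  · simp [update_of_ne h]

variable [Fintype ι]

omit [DecidableEq ι] in
/-- **Expectation of a coin-cylinder slot** under `B_s ⊗ bernoulliWeight q`: `s·M(T) + (1−s)·K·M(B)`. [this work] -/
theorem ex_cSlot (q : ι → unitInterval) (s : ℝ) (T B : Finset ι) (K : ℝ) :
    ex (fun z : Bool × Set ι => if z.1 then s * bernoulliWeight q z.2 else (1 - s) * bernoulliWeight q z.2) (cSlot T B K)
      = s * cylMass (fun e => (q e : ℝ)) T + (1 - s) * K * cylMass (fun e => (q e : ℝ)) B := by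
  rw [ex_coin]
  simp only [cSlot, if_true, Bool.false_eq_true, if_false]
  have e : (fun ω : Set ι => K * ind {ω : Set ι | (B : Set ι) ⊆ ω} ω) = K • fun ω => ind {ω : Set ι | (B : Set ι) ⊆ ω} ω := rfl
  rw [e, ex_smul, ex_ind_cyl', ex_ind_cyl']
  ring

/-! ### Interpolation: scalar families reduce to vertex families -/

/-- **INTERPOLATION THEOREM.**  For every `n`, every `q : ι → [0,1]`, `s ∈ [0,1]`, cylinders `t_l` and scalars `κ ∈ [0,1]^n`:
`s · E_n^{μ}(1_{C(t_0)},…,1_{C(t_{n−1})}) ≤ E_n^{B_s⊗μ}(cSlot t_l t_l κ_l)`.  Slot by slot `cSlot t t κ = κ·(plain) + (1−κ)·(top-only)` and `E_n` is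
linear in each slot, so the claim is a convex combination of its `2^n` vertex instances, which are Theorem V (`vtxD_nonneg`). [this work] -/
theorem sahiE_coin_scalar_ge (q : ι → unitInterval) {s : ℝ} (hs0 : 0 ≤ s) (hs1 : s ≤ 1) {n : ℕ} (t : Fin n → Finset ι)
    (κ : Fin n → ℝ) (hκ0 : ∀ l, 0 ≤ κ l) (hκ1 : ∀ l, κ l ≤ 1) :
    s * sahiE (bernoulliWeight q) n (fun l (ω : Set ι) => ind {ω : Set ι | (t l : Set ι) ⊆ ω} ω) ≤
      sahiE (fun z : Bool × Set ι => if z.1 then s * bernoulliWeight q z.2 else (1 - s) * bernoulliWeight q z.2) n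
        (fun l => cSlot (t l) (t l) (κ l)) := by
  -- claim for all `κ` that are `{0,1}`-valued outside a finite set `A`, by induction on `A`
  suffices h : ∀ A : Finset (Fin n), ∀ κ : Fin n → ℝ, (∀ l, l ∉ A → κ l = 0 ∨ κ l = 1) → (∀ l, 0 ≤ κ l) → (∀ l, κ l ≤ 1) →
      s * sahiE (bernoulliWeight q) n (fun l (ω : Set ι) => ind {ω : Set ι | (t l : Set ι) ⊆ ω} ω) ≤
        sahiE (fun z : Bool × Set ι => if z.1 then s * bernoulliWeight q z.2 else (1 - s) * bernoulliWeight q z.2) n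
          (fun l => cSlot (t l) (t l) (κ l)) from
    h univ κ (fun l hl => absurd (mem_univ l) hl) hκ0 hκ1
  intro A
  induction A using Finset.induction_on with
  | empty =>
    intro κ hbin _ _
    -- a vertex family
    have e : (fun l => cSlot (t l) (t l) (κ l)) = fun l => vtxSlot (decide (κ l = 0)) (t l) := by
      funext l
      rcases hbin l (Finset.notMem_empty l) with h | h
      · rw [h, cSlot_zero]; simp
      · rw [h, cSlot_self_one]; simp
    rw [e]
    have hV := vtxD_nonneg q hs0 hs1 (fun l => decide (κ l = 0)) t
    unfold vtxD at hV
    linarith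
  | insert l₀ A hl₀ ih =>
    intro κ hbin hκ0 hκ1
    have eF : (fun l => cSlot (t l) (t l) (κ l)) = update (fun l => cSlot (t l) (t l) (κ l)) l₀ (cSlot (t l₀) (t l₀) (κ l₀)) := by
      rw [eq_update_self_iff]
    rw [eF, cSlot_lin, sahiE_update_lin]
    have e1 : update (fun l => cSlot (t l) (t l) (κ l)) l₀ (cSlot (t l₀) (t l₀) 1) = fun l => cSlot (t l) (t l) (update κ l₀ 1 l) := by
      rw [update_cSlot_family]; simp
    have e0 : update (fun l => cSlot (t l) (t l) (κ l)) l₀ (cSlot (t l₀) (t l₀) 0) = fun l => cSlot (t l) (t l) (update κ l₀ 0 l) := by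
      rw [update_cSlot_family]; simp
    rw [e1, e0]
    have hb1 : ∀ l, l ∉ A → update κ l₀ 1 l = 0 ∨ update κ l₀ 1 l = 1 := by
      intro l hl
      by_cases h : l = l₀
      · subst h; simp
      · rw [update_of_ne h]; exact hbin l (by simp [h, hl])
    have hb0 : ∀ l, l ∉ A → update κ l₀ 0 l = 0 ∨ update κ l₀ 0 l = 1 := by
      intro l hl
      by_cases h : l = l₀
      · subst h; simp
      · rw [update_of_ne h]; exact hbin l (by simp [h, hl])
    have h1 := ih (update κ l₀ 1) hb1
      (fun l => by by_cases h : l = l₀ <;> simp [h, update_of_ne, hκ0])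
      (fun l => by by_cases h : l = l₀ <;> simp [h, update_of_ne, hκ1])
    have h0 := ih (update κ l₀ 0) hb0
      (fun l => by by_cases h : l = l₀ <;> simp [h, update_of_ne, hκ0])
      (fun l => by by_cases h : l = l₀ <;> simp [h, update_of_ne, hκ1])
    have hk0 := hκ0 l₀
    have hk1 : 0 ≤ 1 - κ l₀ := sub_nonneg.2 (hκ1 l₀)
    nlinarith [mul_le_mul_of_nonneg_left h1 hk0, mul_le_mul_of_nonneg_left h0 hk1]

/-! ### Frozen pair families are scalar families -/

/-- **FROZEN TRANSFER.**  If the defects `b_l ∖ t_l` of a cylinder-pair family `t_l ⊆ b_l` are disjoint from the other bottoms `b_j` (`j ≠ l`), then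
`E_n^{B_s⊗μ}(cSlot t_l b_l 1) = E_n^{B_s⊗μ}(cSlot t_l t_l M(b_l ∖ t_l))`: slot by slot the two candidates have the same mixed moments with the
other slots (`M(b_l ∪ B) = M(b_l ∖ t_l)·M(t_l ∪ B)` for `B` a union of the other slots' cylinders), and `E_n` sees a slot only through them. [this work] -/
theorem sahiE_coin_pairs_eq_scalar_of_frozen (q : ι → unitInterval) (s : ℝ) {n : ℕ} (t b : Fin n → Finset ι) (htb : ∀ l, t l ⊆ b l)
    (hfr : ∀ l j, l ≠ j → Disjoint (b l \ t l) (b j)) :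
    sahiE (fun z : Bool × Set ι => if z.1 then s * bernoulliWeight q z.2 else (1 - s) * bernoulliWeight q z.2) n
        (fun l => cSlot (t l) (b l) 1) =
      sahiE (fun z : Bool × Set ι => if z.1 then s * bernoulliWeight q z.2 else (1 - s) * bernoulliWeight q z.2) n
        (fun l => cSlot (t l) (t l) (cylMass (fun e => (q e : ℝ)) (b l \ t l))) := by
  set ν : Bool × Set ι → ℝ := fun z => if z.1 then s * bernoulliWeight q z.2 else (1 - s) * bernoulliWeight q z.2 with hν
  -- transfer the slots of a finite set `A`, by induction on `A`
  suffices h : ∀ A : Finset (Fin n),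
      sahiE ν n (fun l => cSlot (t l) (b l) 1) =
        sahiE ν n (fun l => cSlot (t l) (if l ∈ A then t l else b l) (if l ∈ A then cylMass (fun e => (q e : ℝ)) (b l \ t l) else 1)) by
    rw [h univ]; simp
  intro A
  induction A using Finset.induction_on with
  | empty => simp
  | insert l₀ A hl₀ ih =>
    rw [ih]
    set β : Fin n → Finset ι := fun l => if l ∈ A then t l else b l with hβ
    set κ : Fin n → ℝ := fun l => if l ∈ A then cylMass (fun e => (q e : ℝ)) (b l \ t l) else 1 with hκ
    have eβ : ∀ l, (if l ∈ insert l₀ A then t l else b l) = update β l₀ (t l₀) l := by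
      intro l
      by_cases h : l = l₀
      · subst h; simp
      · rw [update_of_ne h]; simp [hβ, h]
    have eκ : ∀ l, (if l ∈ insert l₀ A then cylMass (fun e => (q e : ℝ)) (b l \ t l) else 1)
        = update κ l₀ (cylMass (fun e => (q e : ℝ)) (b l₀ \ t l₀)) l := by
      intro l
      by_cases h : l = l₀
      · subst h; simp
      · rw [update_of_ne h]; simp [hκ, h]
    simp only [eβ, eκ]
    rw [← update_cSlot_family t β κ l₀]
    have eold : (fun l => cSlot (t l) (β l) (κ l)) = update (fun l => cSlot (t l) (β l) (κ l)) l₀ (cSlot (t l₀) (b l₀) 1) := by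
      rw [eq_comm, update_eq_self_iff]
      simp [hβ, hκ, hl₀]
    rw [eold, update_idem]
    refine sahiE_update_congr_of_moments ν _ l₀ fun S hS => ?_
    rw [prod_cSlot, cSlot_mul, cSlot_mul, hν, ex_cSlot, ex_cSlot]
    -- the bottom masses: `M(b₀ ∪ B) = M(b₀ \ t₀) · M(t₀ ∪ B)`
    have hdisj : Disjoint (b l₀ \ t l₀) (t l₀ ∪ S.biUnion β) := by
      rw [Finset.disjoint_union_right, Finset.disjoint_biUnion_right]
      refine ⟨Finset.sdiff_disjoint, fun j hj => ?_⟩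
      have hjl : l₀ ≠ j := fun h => hS (h ▸ hj)
      refine (hfr l₀ j hjl).mono_right ?_
      by_cases hjA : j ∈ A
      · simp only [hβ, hjA, if_true]; exact htb j
      · simp only [hβ, hjA, if_false]; exact subset_rfl
    have hunion : b l₀ ∪ S.biUnion β = (b l₀ \ t l₀) ∪ (t l₀ ∪ S.biUnion β) := by
      rw [← Finset.union_assoc, Finset.sdiff_union_of_subset (htb l₀)]
    rw [hunion, cylMass_union_of_disjoint hdisj]
    ring

end

end Summit.CriticalPhenomena.PercolationContinuityZ3.Theorems.SahiTangentCyl
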